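import Summits.CriticalPhenomena.PercolationContinuityZ3.Theorems.PercNearOneGluingNoHeavyLowerTailSahiThreeCopyCellSlotDefs
import Literature.Computability.Complexity.ExtMonotoneGates

/-!
# `NoHeavyLowerTail` (crux stmt-CriticalPhenomena-4575), Sahi programme: the boundary slot families of `C₈`

Support file (Sahi cell, seat `prim-sahi-p1`, generation 65; `--supports stmt-CriticalPhenomena-4575`).  Definitions only.  Freezing front
coordinates of `C₈ = ⋀_{j<4}(x_{2j} ∨ x_{2j+1})` (profile entries `0` / `3`) produces, up to relabelling, the slots

* `X7a = x₀ ∧ (x₁∨x₂) ∧ (x₃∨x₄) ∧ (x₅∨x₆)` and `X7b = (x₀∨x₁) ∧ (x₂∨x₃) ∧ (x₄∨x₅)` on `7` coordinates (`x₆` a dummy),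
* `X6a = x₀ ∧ x₁ ∧ (x₂∨x₃) ∧ (x₄∨x₅)`, `X6b = x₀ ∧ (x₁∨x₂) ∧ (x₃∨x₄)` (`x₅` dummy), `X6d = (x₀∨x₁) ∧ (x₂∨x₃)` (`x₄, x₅` dummies) on `6`,

besides `C₆` and `∅` (the section identities are in `…CellSections`).  For each: the Boolean predicate, the `Finset`, the integer indicator
(for the cell checker) with `setInd_…_eq`, the block structure (for `transScore`; literal blocks have size `1`, dummies belong to no block),
and for the six-coordinate ones the up-set property. [this work]
-/

namespace Summit.CriticalPhenomena.PercolationContinuityZ3.Theorems.SahiThreeCopy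

open Finset Function Literature.Combinatorics.Sahi2008
open scoped BigOperators

/-! ### `X7a = x₀ ∧ C₆(x₁,…,x₆)` -/

/-- `x₀ ∧ (x₁∨x₂) ∧ (x₃∨x₄) ∧ (x₅∨x₆)`. [this work] -/
def x7aB (e : Pt 7) : Bool := e 0 && (e 1 || e 2) && (e 3 || e 4) && (e 5 || e 6)

/-- The slot `X7a` as a `Finset`. [this work] -/
def X7aSet : Finset (Pt 7) := univ.filter fun e => x7aB e = true

/-- Integer indicator of `X7a`. [this work] -/
def x7aZ (e : Pt 7) : ℤ := if x7aB e then 1 else 0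

/-- Blocks of `X7a`: the literal `{0}` and the pairs. [this work] -/
def blocksX7a : List (List (Fin 7)) := [[0], [1, 2], [3, 4], [5, 6]]

/-- `setInd X7aSet` is the real cast of the integer indicator. [this work] -/
theorem setInd_X7aSet_eq : setInd X7aSet = fun x => (x7aZ x : ℝ) := by
  funext x; rw [X7aSet, setInd_filter_eq]; unfold x7aZ; split_ifs <;> simp

/-! ### `X7b = C₆(x₀,…,x₅)` with the dummy `x₆` -/

/-- `(x₀∨x₁) ∧ (x₂∨x₃) ∧ (x₄∨x₅)` on seven coordinates. [this work] -/
def x7bB (e : Pt 7) : Bool := (e 0 || e 1) && (e 2 || e 3) && (e 4 || e 5)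

/-- The slot `X7b` as a `Finset`. [this work] -/
def X7bSet : Finset (Pt 7) := univ.filter fun e => x7bB e = true

/-- Integer indicator of `X7b`. [this work] -/
def x7bZ (e : Pt 7) : ℤ := if x7bB e then 1 else 0

/-- Blocks of `X7b` (coordinate `6` is in no block). [this work] -/
def blocksX7b : List (List (Fin 7)) := [[0, 1], [2, 3], [4, 5]]

/-- `setInd X7bSet` is the real cast of the integer indicator. [this work] -/
theorem setInd_X7bSet_eq : setInd X7bSet = fun x => (x7bZ x : ℝ) := by
  funext x; rw [X7bSet, setInd_filter_eq]; unfold x7bZ; split_ifs <;> simp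

/-! ### `X6a = x₀ ∧ x₁ ∧ C₄(x₂,…,x₅)` -/

/-- `x₀ ∧ x₁ ∧ (x₂∨x₃) ∧ (x₄∨x₅)`. [this work] -/
def x6aB (e : Pt 6) : Bool := e 0 && e 1 && (e 2 || e 3) && (e 4 || e 5)

/-- The slot `X6a` as a `Finset`. [this work] -/
def X6aSet : Finset (Pt 6) := univ.filter fun e => x6aB e = true

/-- Integer indicator of `X6a`. [this work] -/
def x6aZ (e : Pt 6) : ℤ := if x6aB e then 1 else 0

/-- Blocks of `X6a`. [this work] -/
def blocksX6a : List (List (Fin 6)) := [[0], [1], [2, 3], [4, 5]]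

/-- `setInd X6aSet` is the real cast of the integer indicator. [this work] -/
theorem setInd_X6aSet_eq : setInd X6aSet = fun x => (x6aZ x : ℝ) := by
  funext x; rw [X6aSet, setInd_filter_eq]; unfold x6aZ; split_ifs <;> simp

/-- `X6a` is an up-set. [this work] -/
theorem isUpperSet_X6aSet : IsUpperSet ((X6aSet : Finset (Pt 6)) : Set (Pt 6)) := by
  refine isUpperSet_filter_bool fun x y hxy hx => ?_
  simp only [x6aB, Bool.and_eq_true] at hx ⊢
  exact ⟨⟨⟨Literature.Computability.Complexity.eq_true_of_le_of_eq_true (hxy 0) hx.1.1.1, Literature.Computability.Complexity.eq_true_of_le_of_eq_true (hxy 1) hx.1.1.2⟩, or_mono_bool (hxy 2) (hxy 3) hx.1.2⟩,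
    or_mono_bool (hxy 4) (hxy 5) hx.2⟩

/-! ### `X6b = x₀ ∧ C₄(x₁,…,x₄)` with the dummy `x₅` -/

/-- `x₀ ∧ (x₁∨x₂) ∧ (x₃∨x₄)` on six coordinates. [this work] -/
def x6bB (e : Pt 6) : Bool := e 0 && (e 1 || e 2) && (e 3 || e 4)

/-- The slot `X6b` as a `Finset`. [this work] -/
def X6bSet : Finset (Pt 6) := univ.filter fun e => x6bB e = true

/-- Integer indicator of `X6b`. [this work] -/
def x6bZ (e : Pt 6) : ℤ := if x6bB e then 1 else 0

/-- Blocks of `X6b` (coordinate `5` is in no block). [this work] -/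
def blocksX6b : List (List (Fin 6)) := [[0], [1, 2], [3, 4]]

/-- `setInd X6bSet` is the real cast of the integer indicator. [this work] -/
theorem setInd_X6bSet_eq : setInd X6bSet = fun x => (x6bZ x : ℝ) := by
  funext x; rw [X6bSet, setInd_filter_eq]; unfold x6bZ; split_ifs <;> simp

/-- `X6b` is an up-set. [this work] -/
theorem isUpperSet_X6bSet : IsUpperSet ((X6bSet : Finset (Pt 6)) : Set (Pt 6)) := by
  refine isUpperSet_filter_bool fun x y hxy hx => ?_
  simp only [x6bB, Bool.and_eq_true] at hx ⊢
  exact ⟨⟨Literature.Computability.Complexity.eq_true_of_le_of_eq_true (hxy 0) hx.1.1, or_mono_bool (hxy 1) (hxy 2) hx.1.2⟩, or_mono_bool (hxy 3) (hxy 4) hx.2⟩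

/-! ### `X6d = C₄(x₀,…,x₃)` with the dummies `x₄, x₅` -/

/-- `(x₀∨x₁) ∧ (x₂∨x₃)` on six coordinates. [this work] -/
def x6dB (e : Pt 6) : Bool := (e 0 || e 1) && (e 2 || e 3)

/-- The slot `X6d` as a `Finset`. [this work] -/
def X6dSet : Finset (Pt 6) := univ.filter fun e => x6dB e = true

/-- Integer indicator of `X6d`. [this work] -/
def x6dZ (e : Pt 6) : ℤ := if x6dB e then 1 else 0

/-- Blocks of `X6d` (coordinates `4, 5` are in no block). [this work] -/
def blocksX6d : List (List (Fin 6)) := [[0, 1], [2, 3]]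

/-- `setInd X6dSet` is the real cast of the integer indicator. [this work] -/
theorem setInd_X6dSet_eq : setInd X6dSet = fun x => (x6dZ x : ℝ) := by
  funext x; rw [X6dSet, setInd_filter_eq]; unfold x6dZ; split_ifs <;> simp

/-- `X6d` is an up-set. [this work] -/
theorem isUpperSet_X6dSet : IsUpperSet ((X6dSet : Finset (Pt 6)) : Set (Pt 6)) := by
  refine isUpperSet_filter_bool fun x y hxy hx => ?_
  simp only [x6dB, Bool.and_eq_true] at hx ⊢
  exact ⟨or_mono_bool (hxy 0) (hxy 1) hx.1, or_mono_bool (hxy 2) (hxy 3) hx.2⟩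

/-- The interior profile with mask `m` on seven coordinates (`= profB 7 m` of `…CellAssembly`). [this work] -/
def prof7 (m : ℕ) : Fin 7 → ℕ := fun i => if m.testBit i.val then 2 else 1

end Summit.CriticalPhenomena.PercolationContinuityZ3.Theorems.SahiThreeCopy
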